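import Summits.Ventures.HodgeRepro2.T5CoshIntegral

/-!
# T5DoublingExplicit — the archimedean doubling integral of (N4.3.P1) in the rank-one model is
EXPLICIT: `∫₀^∞ cosh(t)^{−w} sinh(2t) dt = 2/(w − 2)` for complex `w` with `Re w > 2`,
kernel-checked

Support for `route/T5-N4-p5.md` (sub-step N4.3 = (R3)), steps (N4.3.P1)–(N4.3.P3).  At `τ′_j`
(`j = 2, 3`) the integrand of `Z_{τ′_j}(s, Φ, f, f)` is, by (P1)–(P2′),
`Φ_s(i(g,1)) · \overline{⟨π₀(g)f, f⟩} = (‖φ‖²/‖f‖²) · |⟨π₀(g)f, f⟩|² · |a(i(g,1))|^{s − 1/2}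
= ‖φ‖²‖f‖² · cosh(t)^{−6} · cosh(t)^{−(s − 1/2)}` — a function of the Cartan coordinate `t` of
`g = k a_t k′` alone (`|⟨π₀(g)f,f⟩| = ‖f‖² cosh(η/2)^{−3}`, `η = 2t`; `|a(i(g,1))| = Δ(g)^{−1/2} =
1/cosh t`).  Against the Cartan density `sinh(2t) dt` of `K\G/K` the `t`-integral is therefore
`∫₀^∞ cosh(t)^{−(s + 11/2)} sinh(2t) dt`, which this file evaluates in closed form for COMPLEX `s`:

* `integral_cosh_cpow_sinh_two_mul`: `∫₀^∞ cosh(t)^{−w} sinh(2t) dt = 2/(w − 2)` for `Re w > 2`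
  (complex antiderivative `−(2/(w − 2)) cosh(t)^{2 − w}`; Mathlib
  `integral_Ioi_of_hasDerivAt_of_tendsto`; integrability from `T5CoshIntegral.epsilon_bound_integrable`);
* `doubling_integral_explicit`: `∫₀^∞ cosh(t)^{−(s + 11/2)} sinh(2t) dt = 2/(s + 7/2)` for
  `Re s > −7/2` — so in the rank-one model `Z_{τ′_j}(s)` is `C_j · 2/(s + 7/2)` with `C_j > 0`:
  holomorphic on `Re s > −7/2`, its meromorphic continuation has a single simple pole at
  `s = −7/2`, and `Z_{τ′_j}(1/2) = C_j/2` (`doubling_integral_at_half`: the value `1/2` =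
  `T5CoshIntegral.ruhl_measure_integral_two` = `epsilon_bound_integral 0`).

Honest scope: the reduction of the group integral to the `t`-integral (the Cartan-coordinate form
of Haar measure on `G`, the normalisation constants `C_j`) is the text's; this file evaluates the
`t`-integral only.
-/

noncomputable section

namespace Summit.Ventures.HodgeRepro2.T5DoublingExplicit

open MeasureTheory Set Filter Topology
open Summit.Ventures.HodgeRepro2.T5CoshIntegral

/-- `cosh t > 0` as a complex number is in the slit plane. -/
theorem cosh_mem_slitPlane (t : ℝ) : ((Real.cosh t : ℝ) : ℂ) ∈ Complex.slitPlane :=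
  Complex.ofReal_mem_slitPlane.mpr (Real.cosh_pos t)

/-- `cosh t ≠ 0` in `ℂ`. -/
theorem cosh_ne_zero (t : ℝ) : ((Real.cosh t : ℝ) : ℂ) ≠ 0 := by
  exact_mod_cast (Real.cosh_pos t).ne'

/-- The derivative of `t ↦ cosh(t)^c` (complex power of the real `cosh`):
`c · cosh(t)^{c−1} · sinh t`. -/
theorem hasDerivAt_cosh_cpow (c : ℂ) (t : ℝ) :
    HasDerivAt (fun t : ℝ => ((Real.cosh t : ℝ) : ℂ) ^ c)
      (c * ((Real.cosh t : ℝ) : ℂ) ^ (c - 1) * (Real.sinh t : ℂ)) t := by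
  -- write the power through the exponential: `cosh^c = exp (c · log cosh)`
  have hfun : (fun t : ℝ => ((Real.cosh t : ℝ) : ℂ) ^ c) =
      fun t : ℝ => Complex.exp (c * ((Real.log (Real.cosh t) : ℝ) : ℂ)) := by
    funext t
    rw [Complex.cpow_def_of_ne_zero (cosh_ne_zero t), ← Complex.ofReal_log (Real.cosh_pos t).le,
      mul_comm]
  rw [hfun]
  have hL : HasDerivAt (fun t : ℝ => Real.log (Real.cosh t)) (Real.sinh t / Real.cosh t) t := by
    have := (Real.hasDerivAt_cosh t).log (Real.cosh_pos t).ne'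
    simpa using this
  have hL' : HasDerivAt (fun t : ℝ => c * ((Real.log (Real.cosh t) : ℝ) : ℂ))
      (c * ((Real.sinh t / Real.cosh t : ℝ) : ℂ)) t :=
    (hL.ofReal_comp).const_mul c
  refine hL'.cexp.congr_deriv ?_
  have hpow : Complex.exp (c * ((Real.log (Real.cosh t) : ℝ) : ℂ)) = ((Real.cosh t : ℝ) : ℂ) ^ c := by
    rw [Complex.cpow_def_of_ne_zero (cosh_ne_zero t), ← Complex.ofReal_log (Real.cosh_pos t).le,
      mul_comm]
  have hsplit : ((Real.cosh t : ℝ) : ℂ) ^ (c - 1) = ((Real.cosh t : ℝ) : ℂ) ^ c / ((Real.cosh t : ℝ) : ℂ) := by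
    rw [Complex.cpow_sub _ _ (cosh_ne_zero t), Complex.cpow_one]
  rw [hpow, hsplit]
  push_cast
  have hc := cosh_ne_zero t
  field_simp

/-- The antiderivative `F(t) = −(2/(w − 2)) · cosh(t)^{2 − w}` of `cosh(t)^{−w} sinh(2t)`. -/
theorem hasDerivAt_antideriv (w : ℂ) (hw : w ≠ 2) (t : ℝ) :
    HasDerivAt (fun t : ℝ => -(2 / (w - 2)) * ((Real.cosh t : ℝ) : ℂ) ^ (2 - w))
      (((Real.cosh t : ℝ) : ℂ) ^ (-w) * (Real.sinh (2 * t) : ℂ)) t := by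
  have h := (hasDerivAt_cosh_cpow (2 - w) t).const_mul (-(2 / (w - 2)))
  refine h.congr_deriv ?_
  have hw' : w - 2 ≠ 0 := sub_ne_zero.mpr hw
  have hc := cosh_ne_zero t
  -- cosh^{2 − w − 1} = cosh^{−w} · cosh
  have hsplit : ((Real.cosh t : ℝ) : ℂ) ^ (2 - w - 1) = ((Real.cosh t : ℝ) : ℂ) ^ (-w) * ((Real.cosh t : ℝ) : ℂ) := by
    rw [show (2 : ℂ) - w - 1 = -w + 1 by ring, Complex.cpow_add _ _ hc, Complex.cpow_one]
  rw [hsplit, Real.sinh_two_mul]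
  push_cast
  field_simp
  ring

/-- Integrability of `cosh(t)^{−w} sinh(2t)` on `(0, ∞)` for `Re w > 2`. -/
theorem integrableOn_integrand {w : ℂ} (hw : 2 < w.re) :
    IntegrableOn (fun t : ℝ => ((Real.cosh t : ℝ) : ℂ) ^ (-w) * (Real.sinh (2 * t) : ℂ)) (Ioi 0) := by
  have hreal := epsilon_bound_integrable (6 - w.re) (by linarith)
  have hcont : Continuous (fun t : ℝ => ((Real.cosh t : ℝ) : ℂ) ^ (-w) * (Real.sinh (2 * t) : ℂ)) := by
    refine Continuous.mul ?_ (Complex.continuous_ofReal.comp (Real.continuous_sinh.comp (continuous_const.mul continuous_id)))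
    exact (Complex.continuous_ofReal.comp Real.continuous_cosh).cpow continuous_const
      (fun t => cosh_mem_slitPlane t)
  refine hreal.mono' hcont.aestronglyMeasurable ?_
  rw [ae_restrict_iff' measurableSet_Ioi]
  refine ae_of_all _ (fun t ht => ?_)
  rw [norm_mul, Complex.norm_cpow_eq_rpow_re_of_pos (Real.cosh_pos t), Complex.norm_real,
    Real.norm_eq_abs, Complex.neg_re, show (6 - w.re) - 6 = -w.re by ring,
    abs_of_nonneg (by
      have : 0 < 2 * t := by linarith [mem_Ioi.mp ht]
      exact (Real.sinh_pos_iff.mpr this).le)]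

/-- `F(t) → 0` as `t → ∞` when `Re w > 2`. -/
theorem tendsto_antideriv {w : ℂ} (hw : 2 < w.re) :
    Tendsto (fun t : ℝ => -(2 / (w - 2)) * ((Real.cosh t : ℝ) : ℂ) ^ (2 - w)) atTop (𝓝 0) := by
  have h1 : Tendsto (fun t : ℝ => ((Real.cosh t : ℝ) : ℂ) ^ (2 - w)) atTop (𝓝 0) := by
    rw [tendsto_zero_iff_norm_tendsto_zero]
    have h2 : Tendsto (fun t : ℝ => Real.cosh t ^ (-(w.re - 2))) atTop (𝓝 0) :=
      (tendsto_rpow_neg_atTop (by linarith)).comp tendsto_cosh_atTop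
    refine h2.congr (fun t => ?_)
    rw [Complex.norm_cpow_eq_rpow_re_of_pos (Real.cosh_pos t)]
    congr 1
    simp only [Complex.sub_re, Complex.re_ofNat]
    ring
  simpa using h1.const_mul (-(2 / (w - 2)))

/-- THE EXPLICIT INTEGRAL: `∫₀^∞ cosh(t)^{−w} sinh(2t) dt = 2/(w − 2)` for complex `w` with `Re w > 2`. -/
theorem integral_cosh_cpow_sinh_two_mul {w : ℂ} (hw : 2 < w.re) :
    ∫ t in Ioi (0 : ℝ), ((Real.cosh t : ℝ) : ℂ) ^ (-w) * (Real.sinh (2 * t) : ℂ) = 2 / (w - 2) := by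
  have hw2 : w ≠ 2 := by
    intro h; rw [h] at hw; simp at hw
  have hcont : ContinuousWithinAt (fun t : ℝ => -(2 / (w - 2)) * ((Real.cosh t : ℝ) : ℂ) ^ (2 - w))
      (Ici 0) 0 := by
    refine Continuous.continuousWithinAt ?_
    exact continuous_const.mul ((Complex.continuous_ofReal.comp Real.continuous_cosh).cpow
      continuous_const (fun t => cosh_mem_slitPlane t))
  rw [integral_Ioi_of_hasDerivAt_of_tendsto hcont (fun t _ => hasDerivAt_antideriv w hw2 t)
    (integrableOn_integrand hw) (tendsto_antideriv hw)]
  simp only [Real.cosh_zero, Complex.ofReal_one, Complex.one_cpow, mul_one, zero_sub, neg_neg]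

/-- THE RANK-ONE DOUBLING INTEGRAL IS EXPLICIT: with `w = s + 11/2`,
`∫₀^∞ cosh(t)^{−(s + 11/2)} sinh(2t) dt = 2/(s + 7/2)` for `Re s > −7/2`. -/
theorem doubling_integral_explicit {s : ℂ} (hs : -7 / 2 < s.re) :
    ∫ t in Ioi (0 : ℝ), ((Real.cosh t : ℝ) : ℂ) ^ (-(s + 11 / 2)) * (Real.sinh (2 * t) : ℂ) =
      2 / (s + 7 / 2) := by
  have hw : 2 < (s + 11 / 2).re := by
    simp only [Complex.add_re, Complex.div_ofNat_re, Complex.re_ofNat]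
    linarith
  rw [integral_cosh_cpow_sinh_two_mul hw]
  congr 1
  ring

/-- At `s = 1/2` the value is `1/2` (= `T5CoshIntegral.ruhl_measure_integral_two`). -/
theorem doubling_integral_at_half :
    ∫ t in Ioi (0 : ℝ), ((Real.cosh t : ℝ) : ℂ) ^ (-((1 / 2 : ℂ) + 11 / 2)) * (Real.sinh (2 * t) : ℂ) =
      1 / 2 := by
  rw [doubling_integral_explicit (by simp only [Complex.div_ofNat_re, Complex.one_re]; norm_num)]
  norm_num

end Summit.Ventures.HodgeRepro2.T5DoublingExplicit

end
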